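import Mathlib
import Literature.Topology.FourManifolds.LefschetzHandlebody
import HarnessLib

/-!
# The standard Lefschetz base `Base g ⊂ ℂ²` is connected, and so is every Lefschetz handlebody
(helper for stub `stub_isLefschetzHandlebody_homology` = NF5
`Literature.Topology.FourManifolds.LefschetzBase.isLefschetzHandlebody_homology` of line
`modp-braid-orbits`, reshape r9, crux `ConvexBisection.AcyclicBisectionExists`, item
stmt-SmoothPoincare4-10508, route route-SmoothPoincare4-ConvexBisection)

The registered stub (Gompf–Stipsicz 1999 §8.2; Kas 1980 — unfolded over the concrete base
`Base g = {rho g ≤ 1/4}`, `rho g = ‖y² − x^{2g+1} − 1‖² + eta ‖x‖²`) asserts first that a Lefschetz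
handlebody `X(F_{g,1}; l)` (`IsLefschetzHandlebody g l X`) is CONNECTED; proved here for all `g, l`,
from tree theorems only (no definitions, no named facts):
* §1 `isPreconnected_rho_le`, `connectedSpace_base`: every sublevel `{rho g ≤ c}`, `0 ≤ c ≤ 1/4`,
  in particular `Base g`, is connected.  The sheet involution `ι(x, y) = (x, −y)` preserves `rho`;
  its orbit map `Φ(x, y) = (x, w)`, `w = y² − x^{2g+1} − 1`, has fibres `{p, ι p}` and star-shaped
  image (scaling `(x, w) ↦ (bx, bw)`, `0 ≤ b ≤ 1`, does not increase `rho`; square roots exist); a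
  clopen set containing the `ι`-fixed branch point `(ζ₀, 0)` meets its `ι`-preimage in a saturated
  clopen `T`, and `Φ(T)`, `Φ(Tᶜ)` are disjoint closed sets (compactness) covering the preconnected
  `Φ(sublevel)`, so `T` is everything.
* §2 `{rho < 1/4}` is connected (increasing union of sublevels) and dense in the base (`1/4` is a
  regular value: strict descent along `v` with `d rho(v) < 0`), so `Base g ∖ ⋃ cores` is connected
  (attaching circles lie in `{rho = 1/4}`); the handle piece `D⁴ ∖ S¹ ⊇` open ball is connected and
  meets the base piece (the tube point `(1/2, 0, 0, 0)` is glued to `α` of it); hence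
  `connectedSpace_of_isLefschetzHandlebody` and `stub_isLefschetzHandlebody_homology_connected`.
-/

noncomputable section

-- the prescribed namespace `Summit.<P>.<Sub>.…` duplicates `SmoothPoincare4` (P = Sub)
set_option linter.dupNamespace false

open scoped Manifold ContDiff Topology
open Set Function Literature.Topology.FourManifolds Literature.Topology.FourManifolds.LefschetzBase

namespace Summit.SmoothPoincare4.SmoothPoincare4.Theorems.AcyclicBisectionExists.ModpBraidOrbits

/-! ## §1 The sublevels `{rho ≤ c}` (in particular the base `Base g = {rho ≤ 1/4}`) are connected -/

/-- `rho` in complex coordinates: `rho g (a, b) = ‖b² − a^{2g+1} − 1‖² + eta ‖a‖²`. [folklore] -/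
theorem rho_mk (g : ℕ) (a b : ℂ) :
    rho g (mk a b) = ‖b ^ 2 - a ^ (2 * g + 1) - 1‖ ^ 2 + eta (‖a‖ ^ 2) := by
  simp only [rho, w, Phi, cx_mk, cy_mk]

/-- `w` in complex coordinates. [folklore] -/
theorem w_mk (g : ℕ) (a b : ℂ) : w g (mk a b) = b ^ 2 - a ^ (2 * g + 1) - 1 := by
  simp only [w, Phi, cx_mk, cy_mk]

/-- Membership in a sublevel of `rho` is `rho ≤ c`. [folklore] -/
theorem mem_base_iff (g : ℕ) (c : ℝ) (p : EuclideanSpace ℝ (Fin 4)) :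
    p ∈ rho g ⁻¹' Iic c ↔ rho g p ≤ c := Iff.rfl

/-- **Star-shaped orbit space.**  On the sublevel `{rho g ≤ c}` the image of the orbit map
`Φ(x, y) = (x, w)` is star-shaped about `0 ∈ ℂ × ℂ`: `(x, w) ↦ (b x, b w)`, `0 ≤ b ≤ 1`, does not
increase `rho = ‖w‖² + eta ‖x‖²`, and every `(x, w)` lifts (a square root of `w + x^{2g+1} + 1`).
[folklore] -/
theorem starConvex_range_orbitMap (g : ℕ) (c : ℝ) : StarConvex ℝ (0 : ℂ × ℂ)
    (range fun p : ↥(rho g ⁻¹' Iic c) => ((cx p.1, w g p.1) : ℂ × ℂ)) := by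
  rintro _ ⟨p, rfl⟩ a b _ hb hab
  rw [smul_zero, zero_add]
  have hb1 : b ≤ 1 := by linarith
  have hp : rho g p.1 ≤ c := p.2
  set x : ℂ := cx p.1
  set v : ℂ := w g p.1
  have hsq : ∀ t : ℝ, (b * t) ^ 2 ≤ t ^ 2 := fun t => by
    rw [mul_pow]; exact mul_le_of_le_one_left (sq_nonneg _) (pow_le_one₀ hb hb1)
  refine ⟨⟨mk ((b : ℂ) * x) (csqrt ((b : ℂ) * v + ((b : ℂ) * x) ^ (2 * g + 1) + 1)), ?_⟩, ?_⟩
  · rw [mem_base_iff, rho_mk, csqrt_sq]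
    have e1 : (b : ℂ) * v + ((b : ℂ) * x) ^ (2 * g + 1) + 1 - ((b : ℂ) * x) ^ (2 * g + 1) - 1 =
        (b : ℂ) * v := by ring
    rw [e1, norm_mul, norm_mul, Complex.norm_real, Real.norm_eq_abs, abs_of_nonneg hb]
    have hrho : rho g p.1 = ‖v‖ ^ 2 + eta (‖x‖ ^ 2) := rfl
    calc (b * ‖v‖) ^ 2 + eta ((b * ‖x‖) ^ 2) ≤ ‖v‖ ^ 2 + eta (‖x‖ ^ 2) :=
          add_le_add (hsq _) (eta_monotone (hsq _))
      _ ≤ c := hrho ▸ hp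
  · simp only [cx_mk, w_mk, csqrt_sq, Prod.smul_mk, Complex.real_smul]
    congr 1
    ring

/-- **The sublevel `{rho g ≤ c} ⊂ ℂ²` is connected for `0 ≤ c ≤ 1/4`** (clopen argument through the
sheet involution `ι(x, y) = (x, −y)`, its orbit map `Φ` and the `ι`-fixed branch point `(ζ₀, 0)`).
[folklore] -/
theorem isPreconnected_rho_le (g : ℕ) {c : ℝ} (hc0 : 0 ≤ c) (hc1 : c ≤ 1 / 4) :
    IsPreconnected (rho g ⁻¹' Iic c) := by
  haveI : CompactSpace ↥(rho g ⁻¹' Iic c) :=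
    isCompact_iff_compactSpace.1 ((isCompact_rho_le g).of_isClosed_subset
      (isClosed_Iic.preimage (contDiff_rho g).continuous) (preimage_mono (Iic_subset_Iic.2 hc1)))
  -- the sheet involution
  let ι : ↥(rho g ⁻¹' Iic c) → ↥(rho g ⁻¹' Iic c) := fun p => ⟨mk (cx p.1) (-cy p.1), by
    have h : rho g p.1 ≤ c := p.2
    rw [mem_base_iff, rho_mk, neg_sq]
    exact h⟩
  have hιc : Continuous ι :=
    (continuous_mk.comp ((contDiff_cx.continuous.comp continuous_subtype_val).prodMk
      ((contDiff_cy.continuous.comp continuous_subtype_val).neg))).subtype_mk _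
  have hιι : ∀ p, ι (ι p) = p := fun p => Subtype.ext (by
    show mk (cx (mk (cx p.1) (-cy p.1))) (-cy (mk (cx p.1) (-cy p.1))) = p.1
    rw [cx_mk, cy_mk, neg_neg, mk_cx_cy])
  -- the orbit map and its fibres
  let Φ : ↥(rho g ⁻¹' Iic c) → ℂ × ℂ := fun p => (cx p.1, w g p.1)
  have hΦc : Continuous Φ := (contDiff_cx.continuous.comp continuous_subtype_val).prodMk
    ((contDiff_w g).continuous.comp continuous_subtype_val)
  have hfib : ∀ p q, Φ p = Φ q → q = p ∨ q = ι p := by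
    intro p q h
    simp only [Φ, Prod.mk.injEq] at h
    obtain ⟨hx, hw⟩ := h
    have hy : cy q.1 ^ 2 = cy p.1 ^ 2 := by
      have h1 : cy p.1 ^ 2 = w g p.1 + cx p.1 ^ (2 * g + 1) + 1 := by simp only [w, Phi]; ring
      have h2 : cy q.1 ^ 2 = w g q.1 + cx q.1 ^ (2 * g + 1) + 1 := by simp only [w, Phi]; ring
      rw [h2, h1, hx, hw]
    rcases sq_eq_sq_iff_eq_or_eq_neg.1 hy with h' | h'
    · exact Or.inl (Subtype.ext (by rw [← mk_cx_cy q.1, ← mk_cx_cy p.1, hx, h']))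
    · exact Or.inr (Subtype.ext (by show q.1 = mk (cx p.1) (-cy p.1); rw [← mk_cx_cy q.1, hx, h']))
  have hpre : IsPreconnected (range Φ) := by
    refine ((starConvex_range_orbitMap g c).isPathConnected ⟨⟨mk 0 1, ?_⟩, ?_⟩).isConnected.isPreconnected
    · rw [mem_base_iff, rho_mk, zero_pow (by omega), norm_zero, eta_of_le (by norm_num)]
      norm_num [hc0]
    · simp only [cx_mk, w_mk, zero_pow (Nat.succ_ne_zero _)]
      norm_num
  -- the branch point, fixed by the involution
  let b : ↥(rho g ⁻¹' Iic c) := ⟨mk (branchPt g 0) 0, by rw [mem_base_iff, rho_mk_branchPt]; exact hc0⟩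
  have hιb : ι b = b := Subtype.ext (by
    show mk (cx (mk (branchPt g 0) 0)) (-cy (mk (branchPt g 0) 0)) = mk (branchPt g 0) 0
    rw [cx_mk, cy_mk, neg_zero])
  -- a clopen set containing the branch point is everything
  have hclopen : ∀ S : Set ↥(rho g ⁻¹' Iic c), IsClopen S → b ∈ S → S = univ := by
    intro S hS hb
    set T : Set ↥(rho g ⁻¹' Iic c) := S ∩ ι ⁻¹' S
    have hT : IsClopen T := hS.inter (hS.preimage hιc)
    have hbT : b ∈ T := ⟨hb, by rw [mem_preimage, hιb]; exact hb⟩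
    have hinv : ∀ p ∈ T, ι p ∈ T := fun p hp => ⟨hp.2, by rw [mem_preimage, hιι]; exact hp.1⟩
    have hT1 : IsClosed (Φ '' T) := (hT.isClosed.isCompact.image hΦc).isClosed
    have hT2 : IsClosed (Φ '' Tᶜ) := (hT.compl.isClosed.isCompact.image hΦc).isClosed
    have hdisj : ∀ z, z ∈ Φ '' T → z ∈ Φ '' Tᶜ → False := by
      rintro _ ⟨p, hp, rfl⟩ ⟨q, hq, hpq⟩
      rcases hfib p q hpq.symm with rfl | rfl
      exacts [hq hp, hq (hinv p hp)]
    have hcov : range Φ ⊆ Φ '' T ∪ Φ '' Tᶜ := by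
      rintro _ ⟨p, rfl⟩
      by_cases hp : p ∈ T
      exacts [Or.inl ⟨p, hp, rfl⟩, Or.inr ⟨p, hp, rfl⟩]
    refine eq_univ_of_univ_subset ((?_ : T = univ) ▸ inter_subset_left)
    by_contra hne
    obtain ⟨q, hq⟩ : Tᶜ.Nonempty := nonempty_compl.2 hne
    obtain ⟨z, -, hz1, hz2⟩ := (isPreconnected_closed_iff.1 hpre) _ _ hT1 hT2 hcov
      ⟨_, ⟨b, rfl⟩, b, hbT, rfl⟩ ⟨_, ⟨q, rfl⟩, q, hq, rfl⟩
    exact hdisj z hz1 hz2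
  haveI : ConnectedSpace ↥(rho g ⁻¹' Iic c) := connectedSpace_iff_clopen.2 ⟨⟨b⟩, fun S hS => by
    by_cases hb : b ∈ S
    · exact Or.inr (hclopen S hS hb)
    · exact Or.inl (compl_univ_iff.1 (hclopen Sᶜ hS.compl hb))⟩
  exact isPreconnected_iff_preconnectedSpace.2 inferInstance

/-- **The standard Lefschetz base `Base g ⊂ ℂ²` is connected**, for every `g`. [folklore] -/
theorem connectedSpace_base (g : ℕ) : ConnectedSpace (Base g) :=
  isConnected_iff_connectedSpace.1 ⟨⟨mk (branchPt g 0) 0, by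
    rw [mem_base_iff, rho_mk_branchPt]; norm_num⟩, isPreconnected_rho_le g (by norm_num) le_rfl⟩

/-! ## §2 Every Lefschetz handlebody over the base is connected -/

/-- The open sublevel `{rho g < 1/4}` is preconnected: the increasing union of the connected
sublevels `{rho g ≤ 1/4 − 1/(n+4)}`, all containing the branch point. [folklore] -/
theorem isPreconnected_rho_lt (g : ℕ) : IsPreconnected {q : EuclideanSpace ℝ (Fin 4) | rho g q < 1 / 4} := by
  have hle : ∀ n : ℕ, 1 / ((n : ℝ) + 4) ≤ 1 / 4 := fun n =>
    one_div_le_one_div_of_le (by norm_num) (by linarith [n.cast_nonneg (α := ℝ)])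
  have hpos : ∀ n : ℕ, 0 < 1 / ((n : ℝ) + 4) := fun n => by positivity
  have hU : {q : EuclideanSpace ℝ (Fin 4) | rho g q < 1 / 4} =
      ⋃ n : ℕ, rho g ⁻¹' Iic (1 / 4 - 1 / ((n : ℝ) + 4)) := by
    ext q
    simp only [mem_setOf_eq, mem_iUnion, mem_preimage, mem_Iic]
    refine ⟨fun hq => ?_, fun ⟨n, hn⟩ => by linarith [hpos n]⟩
    obtain ⟨n, hn⟩ := exists_nat_one_div_lt (by linarith : 0 < 1 / 4 - rho g q)
    have : 1 / ((n : ℝ) + 4) ≤ 1 / ((n : ℝ) + 1) := one_div_le_one_div_of_le (by positivity) (by linarith)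
    exact ⟨n, by linarith⟩
  rw [hU]
  refine isPreconnected_iUnion ⟨mk (branchPt g 0) 0, mem_iInter.2 fun n => ?_⟩ fun n => ?_
  · rw [mem_base_iff, rho_mk_branchPt]
    linarith [hle n]
  · exact isPreconnected_rho_le g (by linarith [hle n]) (by linarith [hpos n])

/-- At a regular point of a function on `ℝ⁴` there is a direction of strict descent. [folklore] -/
theorem exists_fderiv_neg {f : EuclideanSpace ℝ (Fin 4) → ℝ} {p : EuclideanSpace ℝ (Fin 4)}
    (h : ¬ IsMCriticalPt (𝓡 4) f p) : ∃ v : EuclideanSpace ℝ (Fin 4), fderiv ℝ f p v < 0 := by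
  by_contra! hall
  have hzero : ∀ v, fderiv ℝ f p v = 0 := fun v =>
    le_antisymm (by have h1 := hall (-v); rw [map_neg] at h1; linarith) (hall v)
  apply h
  simp only [IsMCriticalPt, mfderiv_eq_fderiv]
  exact ContinuousLinearMap.ext hzero

/-- **`{rho < 1/4}` is dense in the base**: at a point of the regular level `rho = 1/4` the function
decreases strictly along a descent direction. [folklore] -/
theorem mem_closure_rho_lt (g : ℕ) {p : EuclideanSpace ℝ (Fin 4)} (hp : rho g p ≤ 1 / 4) :
    p ∈ closure {q : EuclideanSpace ℝ (Fin 4) | rho g q < 1 / 4} := by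
  rcases hp.lt_or_eq with hlt | heq
  · exact subset_closure hlt
  obtain ⟨v, hv⟩ := exists_fderiv_neg ((isRegularLevel_rho g).not_isMCriticalPt heq)
  have hline := hasDerivAt_comp_line ((contDiff_rho g).differentiable (by simp)) p v
  have hev : ∀ᶠ t in 𝓝[>] (0 : ℝ), p + t • v ∈ {q : EuclideanSpace ℝ (Fin 4) | rho g q < 1 / 4} := by
    have h1 : ∀ᶠ z in 𝓝[>] (0 : ℝ), slope (fun t : ℝ => rho g (p + t • v)) 0 z < 0 :=
      hline.hasDerivWithinAt.limsup_slope_le' (fun h0 : (0 : ℝ) ∈ Ioi 0 => lt_irrefl (0 : ℝ)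
        (mem_Ioi.1 h0)) hv
    filter_upwards [h1, self_mem_nhdsWithin] with z hz hzpos
    rw [slope_def_field, zero_smul, add_zero, sub_zero] at hz
    rcases div_neg_iff.1 hz with ⟨-, h2⟩ | ⟨h3, -⟩
    · exact absurd (mem_Ioi.1 hzpos) (not_lt.2 h2.le)
    · show rho g (p + z • v) < 1 / 4
      linarith
  have htend : Filter.Tendsto (fun t : ℝ => p + t • v) (𝓝[>] 0) (𝓝 p) := by
    have h := (show Continuous (fun t : ℝ => p + t • v) by fun_prop).tendsto 0
    rw [zero_smul, add_zero] at h
    exact h.mono_left nhdsWithin_le_nhds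
  exact mem_closure_of_tendsto htend hev

/-- Interior points of the base (`rho < 1/4`) are off every attaching circle (which lies in the
boundary `rho = 1/4`). [folklore] -/
theorem mem_coresComplement_of_rho_lt {g : ℕ} {ι : Type*} [Finite ι]
    (h : ι → HandleAttachingMap 3 2 (Base g)) {p : Base g} (hp : rho g p.1 < 1 / 4) :
    p ∈ HandleAttachingMap.coresComplement h := by
  rw [HandleAttachingMap.mem_coresComplement]
  intro i hi
  exact absurd ((RegularSublevel.mem_boundary_iff (isRegularLevel_rho g) p).1
    ((h i).core_subset_boundary hi)) (ne_of_lt hp)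

/-- **The base minus finitely many attaching circles is connected**: it contains the connected
dense subset `{rho < 1/4}`. [folklore] -/
theorem isPreconnected_coresComplement {g : ℕ} {ι : Type*} [Finite ι]
    (h : ι → HandleAttachingMap 3 2 (Base g)) :
    IsPreconnected ((HandleAttachingMap.coresComplement h : Set (Base g))) := by
  set V : Set (Base g) := {p | rho g p.1 < 1 / 4}
  have hemb := RegularSublevel.isEmbedding_incl (isRegularLevel_rho g)
  have himg : (RegularSublevel.incl (isRegularLevel_rho g) '' V : Set (EuclideanSpace ℝ (Fin 4))) =
      {q | rho g q < 1 / 4} := by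
    ext q
    exact ⟨fun ⟨p, hp, hpq⟩ => hpq ▸ hp, fun hq => ⟨⟨q, (mem_base_iff g (1 / 4) q).2 hq.le⟩, hq, rfl⟩⟩
  have hV : IsPreconnected V := by
    refine hemb.isInducing.isPreconnected_image.1 ?_
    rw [himg]
    exact isPreconnected_rho_lt g
  refine hV.subset_closure (fun p hp => mem_coresComplement_of_rho_lt h hp) fun p _ => ?_
  rw [hemb.closure_eq_preimage_closure_image, himg]
  exact mem_closure_rho_lt g p.2

/-- **The handle piece `D⁴ ∖ S¹` is connected**: it contains the convex open unit ball, which is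
dense in `D⁴`. [folklore] -/
theorem isPreconnected_beltPiece :
    IsPreconnected ((beltPiece 3 2 : TopologicalSpace.Opens (Metric.closedBall
      (0 : EuclideanSpace ℝ (Fin 4)) 1)) : Set (Metric.closedBall (0 : EuclideanSpace ℝ (Fin 4)) 1)) := by
  set B : Set (Metric.closedBall (0 : EuclideanSpace ℝ (Fin 4)) 1) :=
    {u | ‖(u : EuclideanSpace ℝ (Fin 4))‖ < 1}
  have hBsub : B ⊆ (beltPiece 3 2 : Set (Metric.closedBall (0 : EuclideanSpace ℝ (Fin 4)) 1)) := by
    intro u hu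
    rw [SetLike.mem_coe, mem_beltPiece]
    exact fun h1 => absurd (norm_eq_one_of_mem_attachingSphereSet 3 2 h1) (ne_of_lt hu)
  have himg : (Subtype.val '' B : Set (EuclideanSpace ℝ (Fin 4))) = Metric.ball 0 1 := by
    ext q
    simp only [mem_image, Metric.mem_ball, dist_zero_right]
    exact ⟨fun ⟨u, hu, huq⟩ => huq ▸ hu,
      fun hq => ⟨⟨q, Metric.mem_closedBall.2 (by rw [dist_zero_right]; exact hq.le)⟩, hq, rfl⟩⟩
  have hB : IsPreconnected B := by
    rw [← Topology.IsInducing.subtypeVal.isPreconnected_image, himg]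
    exact (convex_ball (0 : EuclideanSpace ℝ (Fin 4)) 1).isPreconnected
  refine hB.subset_closure hBsub fun u _ => ?_
  rw [Topology.IsEmbedding.subtypeVal.closure_eq_preimage_closure_image, himg,
    closure_ball (0 : EuclideanSpace ℝ (Fin 4)) one_ne_zero]
  exact u.2

/-- **A simultaneous attachment of 2-handles to the base is connected.**  The pieces `Base g ∖ ⋃ cores`
and `D⁴ ∖ S¹` are connected, and each handle piece meets the image of the base: the tube point
`y = (1/2, 0, 0, 0)` (`|x_λ|² = 1/4`) is glued to `α(y)`. [folklore] -/
theorem connectedSpace_of_isMultiAttachment {g : ℕ} {ι : Type*} [Finite ι]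
    {h : ι → HandleAttachingMap 3 2 (Base g)} {X : Type*} [TopologicalSpace X]
    [ChartedSpace (EuclideanHalfSpace 4) X]
    (hX : HandleAttachingMap.IsMultiAttachment h (𝓡∂ 4) X) : ConnectedSpace X := by
  obtain ⟨hdisj, jA, jB, hA, -, hB, hcover, hglue, -⟩ := hX
  haveI : PreconnectedSpace ↥(HandleAttachingMap.coresComplement h) :=
    Subtype.preconnectedSpace (isPreconnected_coresComplement h)
  haveI : PreconnectedSpace ↥(beltPiece 3 2) := Subtype.preconnectedSpace isPreconnected_beltPiece
  have hRA : IsPreconnected (range jA) := isPreconnected_range hA.isEmbedding.continuous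
  -- the test point of the tube
  let y : ↥(handleTube 3 2) := ⟨⟨mk (1 / 2 : ℂ) 0, by
      have h' : ‖mk (1 / 2 : ℂ) 0‖ ^ 2 = 1 / 4 := by rw [norm_sq_eq, cx_mk, cy_mk]; norm_num
      rw [Metric.mem_closedBall, dist_zero_right]
      nlinarith [norm_nonneg (mk (1 / 2 : ℂ) 0)]⟩, by
    rw [mem_handleTube]
    show lamSq 2 (mk (1 / 2 : ℂ) 0) ≠ 0
    rw [lamSq_two_fin_four]
    norm_num [mk]⟩
  have hy1 : lamSq 2 (((y : ↥(handleTube 3 2)) : Metric.closedBall (0 : EuclideanSpace ℝ (Fin 4)) 1) :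
      EuclideanSpace ℝ (Fin 4)) ≠ 1 := by
    show lamSq 2 (mk (1 / 2 : ℂ) 0) ≠ 1
    rw [lamSq_two_fin_four]
    norm_num [mk]
  have hmeet : ∀ i, ∃ x, x ∈ range jA ∧ x ∈ range (jB i) := by
    intro i
    have hrel := (h i).glueRel_apply y hy1
    have ha : (h i).toFun y ∈ HandleAttachingMap.coresComplement h := by
      rw [HandleAttachingMap.mem_coresComplement]
      intro j
      by_cases hij : j = i
      · subst hij
        exact hrel.not_mem_core
      · intro hj
        obtain ⟨y', -, hy'⟩ := ((h j).mem_core_iff).1 hj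
        exact Set.disjoint_left.1 (hdisj hij) ⟨y', hy'⟩ ⟨y, rfl⟩
    have hb : ((handleInversionPt ((y : ↥(handleTube 3 2)) : Metric.closedBall
        (0 : EuclideanSpace ℝ (Fin 4)) 1) y.2 hy1 : ↥(handleTube 3 2)) :
        Metric.closedBall (0 : EuclideanSpace ℝ (Fin 4)) 1) ∈ beltPiece 3 2 := by
      rw [mem_beltPiece, coe_coe_handleInversionPt]
      exact (handleInversion_mem y.2 hy1).2.2
    exact ⟨jA ⟨_, ha⟩, ⟨_, rfl⟩, ⟨⟨_, hb⟩, ((hglue i ⟨_, ha⟩ ⟨_, hb⟩).2 hrel).symm⟩⟩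
  have h0 : (chordEnd g 0 : Base g) ∈ HandleAttachingMap.coresComplement h := by
    refine mem_coresComplement_of_rho_lt h ?_
    show rho g (mk (branchPt g 0) 0) < 1 / 4
    rw [rho_mk_branchPt]; norm_num
  set x₀ : X := jA ⟨chordEnd g 0, h0⟩
  have hx₀ : x₀ ∈ range jA := mem_range_self _
  let S : Option ι → Set X := fun o => o.elim (range jA) fun i => range jA ∪ range (jB i)
  have hS : ∀ o, IsPreconnected (S o) := by
    rintro (_ | i)
    exacts [hRA, let ⟨x, hx1, hx2⟩ := hmeet i
      hRA.union x hx1 hx2 (isPreconnected_range (hB i).1.isEmbedding.continuous)]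
  have hxS : ∀ o, x₀ ∈ S o := by rintro (_ | i); exacts [hx₀, Or.inl hx₀]
  have hU : (⋃ o, S o) = univ := by
    refine eq_univ_of_univ_subset (hcover ▸ ?_)
    rintro x (hx | hx)
    · exact mem_iUnion.2 ⟨none, hx⟩
    · exact let ⟨i, hi⟩ := mem_iUnion.1 hx; mem_iUnion.2 ⟨some i, Or.inr hi⟩
  exact { isPreconnected_univ := hU ▸ isPreconnected_iUnion ⟨x₀, mem_iInter.2 hxS⟩ hS
          toNonempty := ⟨x₀⟩ }

/-- **Every (achiral) Lefschetz handlebody `X(F_{g,1}; l)` over the standard base is connected** —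
the first clause of NF5 `LefschetzBase.isLefschetzHandlebody_homology`, for every `g` and every
word `l`. [folklore] -/
theorem connectedSpace_of_isLefschetzHandlebody {g : ℕ} {l : List ((Fin g ⊕ Fin g → ℤ) × Bool)}
    {X : Type*} [TopologicalSpace X] [ChartedSpace (EuclideanHalfSpace 4) X]
    (hX : IsLefschetzHandlebody g l X) : ConnectedSpace X := by
  obtain ⟨h, -, hmulti⟩ := hX
  exact connectedSpace_of_isMultiAttachment hmulti

/-- **Clause (1) of the registered stub `stub_isLefschetzHandlebody_homology`, binders verbatim**:
a Lefschetz handlebody is connected. [folklore] -/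
theorem stub_isLefschetzHandlebody_homology_connected :
    ∀ (g : ℕ) (l : List ((Fin g ⊕ Fin g → ℤ) × Bool)) (X : Type) [TopologicalSpace X] [T2Space X]
      [SecondCountableTopology X] [CompactSpace X] [ChartedSpace (EuclideanHalfSpace 4) X]
      [IsManifold (𝓡∂ 4) ∞ X],
      IsLefschetzHandlebody g l X → ConnectedSpace X :=
  fun _ _ _ _ _ _ _ _ _ hX => connectedSpace_of_isLefschetzHandlebody hX

end Summit.SmoothPoincare4.SmoothPoincare4.Theorems.AcyclicBisectionExists.ModpBraidOrbits
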